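import Summits.CriticalPhenomena.PercolationContinuityZ3.Theorems.Transplant.SkelPhiParaCorridorKGY
import Summits.CriticalPhenomena.PercolationContinuityZ3.Theorems.Transplant.SkelPhiCorridorKGPrism
import HarnessLib

/-!
# N2 (frames-only node `SamePDropOfSkeletonFrm₁`, OPEN), (C) column, ROOM item (c), second axis: **THE PRISM OF THE SECOND-AXIS K-G CORRIDOR IN
# CLOSED FORM** — `mem_kgCorrSchedY_prism_rec` / `mem_kgCorrSchedY_prism_cases` / `kgCorrSchedY_region_subset_prism`: the twin of
# SkelPhiCorridorKGPrism §2 for `kgCorrSchedY hn hv hlay hP₁ hP₂ hsplit` (y′-run on axis `1`, x-parking about the drift line `(N+1)v`, y′-parking),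
# all in the x-run frame's coordinates (σ = 1).  With `fine_sub_ctr_mem_rd` (KGPrism §1), `mem_kgCorrSchedY_core_zero` and
# `kgCorrSchedY_core_last_subset` (SkelPhiParaCorridorKGY) these are the frame-side readings for the second-axis geometry rows.
builds on p205010 (kernel theorem, internal audit signed; external expert review pending) — nothing in this file uses p205010; nothing here is a
claim about the open node `SamePDropOfSkeletonFrm₁`.
Lane `prim-bschramm`, seat `prim-bschramm-p5` (gen 15; (C) lineage); helper file (`--supports stmt-CriticalPhenomena-4575 --as helper`).
[cite: KozmaNitzan2024, §4 Lemma 11 (p. 22: Ω), Lemma 12 (pp. 23–25)] [cite: MartineauTassion2017, §4.3 Lemma 4.2]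
-/

noncomputable section

namespace Summit.CriticalPhenomena.PercolationContinuityZ3.Theorems.Transplant

namespace Skelφ

open Literature.Probability.Percolation Literature.Probability.LatticeModels SimpleGraph
open Literature.Probability.Percolation.KozmaNitzan.Cells (oth oth_oth)
open ChainPlanar ChainPara

variable {V : Type} {G : SimpleGraph V} {φ : V → Site 2}

/-- `oth 1 = 0`. [folklore] -/
private theorem oth_one'' : oth (1 : Fin 2) = 0 := by decide

section KGY

variable {n ℓ : ℕ} {h v : ℤ} {R' ρ q W N m₁ Wm₂ Wp₂ m₂ : ℕ} (hn : 1 ≤ n) (hv : |v| ≤ n) (hlay : (n + h.natAbs : ℕ) ≤ (n : ℤ) * ℓ + 1)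
  (hP₁ : ParkOK (kgPark₁Y n ℓ h v R' ρ q W N m₁)) (hP₂ : ParkOK (kgPark₂Y n ℓ h v R' ρ q W N m₁ Wm₂ Wp₂ m₂))
  (hsplit : (Wm₂ : ℤ) + Wp₂ = (kgPark₁Y n ℓ h v R' ρ q W N m₁).aHi (m₁ + 1) - ParkPrm.aLo (kgPark₁Y n ℓ h v R' ρ q W N m₁) (m₁ + 1))

/-- **THE PRISM OF THE SECOND-AXIS K-G CORRIDOR, RECORD LEVEL**: run's prism (axis `1`, origin `0`), across-parking's (axis `0`, origin `kgC₁Y`),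
along-parking's (axis `1`, origin `kgC₂Y`), each in its record's coordinates (`sLo := ⌊(nℓ − U + 1)/U⌋`). [this work] -/
theorem mem_kgCorrSchedY_prism_rec {y : Site 2} (hy : y ∈ (kgCorrSchedY hn hv hlay hP₁ hP₂ hsplit).prism) :
    RunPrm.InPrism (yRunPrmB n ℓ h v R' q W N) (y 1) (y 0) ∨
    ParkPrm.InPrism (kgPark₁Y n ℓ h v R' ρ q W N m₁) (y 0 - ((N : ℤ) + 1) * v)
      (y 1 - ((N : ℤ) + 1) * (((n : ℤ) * ℓ - (shearUnit n h : ℕ) + 1) / (shearUnit n h : ℕ))) ∨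
    ParkPrm.InPrism (kgPark₂Y n ℓ h v R' ρ q W N m₁ Wm₂ Wp₂ m₂) (y 1 - ((N : ℤ) + 1) * (((n : ℤ) * ℓ - (shearUnit n h : ℕ) + 1) / (shearUnit n h : ℕ)))
      (y 0 - (((N : ℤ) + 1) * v + (kgPark₁Y n ℓ h v R' ρ q W N m₁).aHi (m₁ + 1) - Wp₂)) := by
  have hP : (kgCorrSchedY hn hv hlay hP₁ hP₂ hsplit).prism = (yRunPrmB n ℓ h v R' q W N).pprism (oth 0) 1 0 ∪
      (kgPark₁Y n ℓ h v R' ρ q W N m₁).pprism (oth (oth 0)) 1 (kgC₁Y n ℓ h v N) ∪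
      (kgPark₂Y n ℓ h v R' ρ q W N m₁ Wm₂ Wp₂ m₂).pprism (oth 0) 1 (kgC₂Y n ℓ h v R' ρ q W N m₁ Wp₂) :=
    (corrSchedNP_params _ _ _ _ _ _ _ _ _ _ _ _ _ _ _ _ _ _ _).2.2.2
  rw [hP, Finset.mem_union, Finset.mem_union] at hy
  rcases hy with (hy | hy) | hy
  · left
    have h' := (RunPrm.mem_pprism_iff (P := yRunPrmB n ℓ h v R' q W N) (a := oth 0) (c := 0) (Or.inl rfl)).1 hy
    simpa [oth_zero, oth_one''] using h'
  · right; left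
    have h' := (ParkPrm.mem_pprism_iff (P := kgPark₁Y n ℓ h v R' ρ q W N m₁) (a := oth (oth 0)) (c := kgC₁Y n ℓ h v N) (Or.inl rfl)).1 hy
    simpa [oth_zero, oth_one'', kgC₁Y] using h'
  · right; right
    have h' := (ParkPrm.mem_pprism_iff (P := kgPark₂Y n ℓ h v R' ρ q W N m₁ Wm₂ Wp₂ m₂) (a := oth 0) (c := kgC₂Y n ℓ h v R' ρ q W N m₁ Wp₂)
      (Or.inl rfl)).1 hy
    simpa [oth_zero, oth_one'', kgC₂Y] using h'

/-- **THE PRISM OF THE SECOND-AXIS K-G CORRIDOR IN CLOSED FORM** (`U := shearUnit n h`, `sH := ⌊nℓ/U⌋ + 1`, `sL := ⌊(nℓ−U+1)/U⌋`, `L := ⌊3nℓ/U⌋ + 1`,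
`A⁻ := (n+v)⁺ + W + (N+1)R′`, `A⁺ := (n−v)⁺ + W + (N+1)R′`, `Wq := q + (N+1)R′`, `dS`, `B⁻ := Wq + (m₁+1)(R′+ρ)`, `B⁺ := Wq + (N+1)dS + (m₁+1)(R′+ρ)`):
(run) `−(q+(N+1)R′+L) ≤ y₁ ≤ N·sH + q + (N+1)R′ + L ∧ −(N|v| + (n+v)⁺ + W + (N+1)R′ + n) ≤ y₀ ≤ N|v| + (n−v)⁺ + W + (N+1)R′ + n`;
(across-parking) `min(−A⁻, A⁺+1−n) − R′ − n ≤ y₀ − (N+1)v ≤ A⁺ + m₁(R′+ρ) + R′ + n ∧ −Wq − m₁(R′+ρ) − R′ − L ≤ y₁ − (N+1)sL ≤ Wq + (N+1)dS + m₁(R′+ρ) + R′ + L`;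
(along-parking) `min(−B⁻, B⁺+1−sH) − R′ − L ≤ y₁ − (N+1)sL ≤ B⁺ + m₂(R′+ρ) + R′ + L ∧
 −Wm₂ − m₂(R′+ρ+|v|) − R′ − n ≤ y₀ − ((N+1)v + A⁺ + (m₁+1)(R′+ρ) − Wp₂) ≤ Wp₂ + m₂(R′+ρ+|v|) + R′ + n`. [this work] -/
theorem mem_kgCorrSchedY_prism_cases {y : Site 2} (hy : y ∈ (kgCorrSchedY hn hv hlay hP₁ hP₂ hsplit).prism) :
    (-((q : ℤ) + (N + 1) * R' + (3 * (n * ℓ) / shearUnit n h + 1 : ℕ)) ≤ y 1 ∧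
      y 1 ≤ (N : ℤ) * ((n : ℤ) * ℓ / (shearUnit n h : ℕ) + 1) + q + (N + 1) * R' + (3 * (n * ℓ) / shearUnit n h + 1 : ℕ) ∧
      -((N : ℤ) * |v| + ((n + v).toNat + W : ℕ) + (N + 1) * R' + n) ≤ y 0 ∧
      y 0 ≤ (N : ℤ) * |v| + ((n - v).toNat + W : ℕ) + (N + 1) * R' + n) ∨
    (min (-((kgA₁Ym n v R' W N : ℕ) : ℤ)) ((kgA₁Yp n v R' W N : ℕ) + 1 - n) - R' - n ≤ y 0 - ((N : ℤ) + 1) * v ∧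
      y 0 - ((N : ℤ) + 1) * v ≤ (kgA₁Yp n v R' W N : ℕ) + (m₁ : ℤ) * (R' + ρ) + R' + n ∧
      -((q : ℤ) + (N + 1) * R') - (m₁ : ℤ) * (R' + ρ) - R' - (3 * (n * ℓ) / shearUnit n h + 1 : ℕ) ≤
          y 1 - ((N : ℤ) + 1) * (((n : ℤ) * ℓ - (shearUnit n h : ℕ) + 1) / (shearUnit n h : ℕ)) ∧
      y 1 - ((N : ℤ) + 1) * (((n : ℤ) * ℓ - (shearUnit n h : ℕ) + 1) / (shearUnit n h : ℕ)) ≤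
          (q : ℤ) + (N + 1) * R' + (N + 1) * (dS n ℓ h : ℕ) + (m₁ : ℤ) * (R' + ρ) + R' + (3 * (n * ℓ) / shearUnit n h + 1 : ℕ)) ∨
    (min (-((q : ℤ) + (N + 1) * R') - ((m₁ : ℤ) + 1) * (R' + ρ))
          ((q : ℤ) + (N + 1) * R' + (N + 1) * (dS n ℓ h : ℕ) + ((m₁ : ℤ) + 1) * (R' + ρ) + 1 - ((n : ℤ) * ℓ / (shearUnit n h : ℕ) + 1)) - R' -
          (3 * (n * ℓ) / shearUnit n h + 1 : ℕ) ≤ y 1 - ((N : ℤ) + 1) * (((n : ℤ) * ℓ - (shearUnit n h : ℕ) + 1) / (shearUnit n h : ℕ)) ∧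
      y 1 - ((N : ℤ) + 1) * (((n : ℤ) * ℓ - (shearUnit n h : ℕ) + 1) / (shearUnit n h : ℕ)) ≤
          (q : ℤ) + (N + 1) * R' + (N + 1) * (dS n ℓ h : ℕ) + ((m₁ : ℤ) + 1) * (R' + ρ) + m₂ * (R' + ρ) + R' + (3 * (n * ℓ) / shearUnit n h + 1 : ℕ) ∧
      -(Wm₂ : ℤ) - (m₂ : ℤ) * (R' + ρ + |v|) - R' - n ≤ y 0 - (((N : ℤ) + 1) * v + ((kgA₁Yp n v R' W N : ℕ) + ((m₁ : ℤ) + 1) * (R' + ρ)) - Wp₂) ∧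
      y 0 - (((N : ℤ) + 1) * v + ((kgA₁Yp n v R' W N : ℕ) + ((m₁ : ℤ) + 1) * (R' + ρ)) - Wp₂) ≤ (Wp₂ : ℤ) + (m₂ : ℤ) * (R' + ρ + |v|) + R' + n) := by
  have hg₁ : ((kgPark₁Y n ℓ h v R' ρ q W N m₁).g : ℤ) = R' + ρ := by
    rw [ParkPrm.g_eq]; simp [kgPark₁Y, xParkPrmW]
  have hg₂ : ((kgPark₂Y n ℓ h v R' ρ q W N m₁ Wm₂ Wp₂ m₂).g : ℤ) = R' + ρ + |v| := by
    rw [ParkPrm.g_eq]; simp [kgPark₂Y, yParkPrmW]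
  have eHi : (kgPark₁Y n ℓ h v R' ρ q W N m₁).aHi (m₁ + 1) = ((kgA₁Yp n v R' W N : ℕ) : ℤ) + ((m₁ : ℤ) + 1) * (R' + ρ) := by
    simp only [ParkPrm.aHi, kgPark₁Y, xParkPrmW]; push_cast; ring
  rcases mem_kgCorrSchedY_prism_rec hn hv hlay hP₁ hP₂ hsplit hy with hr | hp | hp
  · left
    simp only [RunPrm.InPrism, yRunPrmB, yPrmW] at hr
    obtain ⟨h1, h2, h3, h4⟩ := hr
    push_cast at h1 h2 h3 h4 ⊢
    exact ⟨by linarith, by linarith, by linarith, by linarith⟩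
  · right; left
    simp only [ParkPrm.InPrism, ParkPrm.aBot] at hp
    rw [hg₁] at hp
    simp only [kgPark₁Y, xParkPrmW] at hp
    obtain ⟨h1, h2, h3, h4⟩ := hp
    push_cast at h1 h2 h3 h4 ⊢
    exact ⟨by linarith, by linarith, by linarith, by linarith⟩
  · right; right
    rw [eHi] at hp
    simp only [ParkPrm.InPrism, ParkPrm.aBot] at hp
    rw [hg₂] at hp
    have hbLo : (kgPark₂Y n ℓ h v R' ρ q W N m₁ Wm₂ Wp₂ m₂).aLo0 = -((q : ℤ) + (N + 1) * R') - ((m₁ : ℤ) + 1) * (R' + ρ) := by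
      show (kgPark₁Y n ℓ h v R' ρ q W N m₁).bLo (m₁ + 1) = _
      simp only [ParkPrm.bLo]; push_cast; rw [hg₁]; simp [kgPark₁Y, xParkPrmW]
    have hbHi : (kgPark₂Y n ℓ h v R' ρ q W N m₁ Wm₂ Wp₂ m₂).A =
        (q : ℤ) + (N + 1) * R' + (N + 1) * (dS n ℓ h : ℕ) + ((m₁ : ℤ) + 1) * (R' + ρ) := by
      show (kgPark₁Y n ℓ h v R' ρ q W N m₁).bHi (m₁ + 1) = _
      simp only [ParkPrm.bHi]; push_cast; rw [hg₁]; simp [kgPark₁Y, xParkPrmW]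
    rw [hbLo, hbHi] at hp
    simp only [kgPark₂Y, yParkPrmW] at hp
    obtain ⟨h1, h2, h3, h4⟩ := hp
    push_cast at h1 h2 h3 h4 ⊢
    exact ⟨by linarith, by linarith, by linarith, by linarith⟩

/-- **Every region of the second-axis K-G corridor lies in its prism.** [folklore] -/
theorem kgCorrSchedY_region_subset_prism {k : ℕ} (hk : k ≤ (kgCorrSchedY hn hv hlay hP₁ hP₂ hsplit).N) :
    (kgCorrSchedY hn hv hlay hP₁ hP₂ hsplit).region k ⊆ (kgCorrSchedY hn hv hlay hP₁ hP₂ hsplit).prism :=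
  (kgCorrSchedY hn hv hlay hP₁ hP₂ hsplit).sub_prism k hk

end KGY

end Skelφ

end Summit.CriticalPhenomena.PercolationContinuityZ3.Theorems.Transplant

end
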